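import Summits.QuantumFields.YangMills.Theorems.BalabanUVNodesK0SingleBondStarLoops
import HarnessLib

/-!
# N07 [B11] ∕ K0⁷ chart road — THE SEAM WITNESS, part A: walk bookkeeping for TWO-CONFIGURATION avoidance, the (0.4) loop variables of a bond twisted at an
# ARBITRARY transverse offset of a block interface, and `exp[mean log] = 1` for an antisymmetric two-connector twist

Cell `pub-ymgap`, seat `pub-ymgap-dag-n07-w3` g15 (WIDTH SEAT 3 on N07).  `--kind proof --supports stmt-QuantumFields-20541 --as helper` (K0⁷; count-neutral;
NEGATIVE-SIDE helper).  [I] = [Balaban1987RG1]; [B7] = [Balaban1985Averaging]; [15] = [Balaban1985Variational]; [II] = [Balaban1984PropagatorsII].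

WHY.  Director-ym №335 (B) (2026-08-30) records, «by reading» (dag-n07-e g33 `LOCATE-HSEAM` (γ)), that the displayed premise HSEAM of the K0⁷ chart road
(✓p764312 `…N07JunctionHsupOfSmallness.prop8StepCoPGridGAt_of_seam`, binder `hseam`) is not inhabitable: criticality on the record's (b)-fibre
(`IsCritOnFibre … (genSet s.Ω k)`, all bonds MEETING `Γ_j`) does not give stationarity along curves keeping only [II] (2.3)'s `Λ_j`-averages.  This series
(parts A–C) TYPES the counter-model WITHOUT any minimiser: part A (this file) is the walk∕average bookkeeping it needs about the TREE's own (0.4) block averaging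
`BlockAveraging.blockAvg ExpMeanLog.expMeanLogSU`, in the style of dag-n21-c's single-bond series (`…K0SingleBondWalks∕StarLoops`, cited by name, nothing restated):
§1 two configurations that differ only on bonds whose far ends a walk never visits have the same holonomy along it; §2 hence `Ū(c)`, the loop variables and
the straight transporter of (0.4) at `c` agree for two configurations differing only on bonds whose targets one coordinate of the (0.4) box at `c` misses;
§3 holonomy is multiplicative on pointwise products of COMMUTING configurations; §4 the loop variables at `c⋆ = ⟨y₁, μ₀⟩` of the configuration twisted at ONE
bond of the interface `B(y₁) | B(y₁ + e_{μ₀})` at transverse offset `ρ` (dag-n21-c's `loopHol_single_star` is `ρ = 0`): `g` on the `L·(d!)²` indices on the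
bond's axis, `1` elsewhere, straight transporter `1` (bond off the central axis).  Part A′ (`…N07SeamWitnessStar`) adds `exp[mean log] = 1` for the
antisymmetric two-connector twist; parts B–C build the witness.

HONEST FRAMING: kernel bookkeeping about the tree's averaging; nothing of Bałaban [I]∕[B7]∕[15] asserted or refuted; used ONLY by parts B–C to certify that
HSEAM AS DISPLAYED is uninhabited (№335 (B) as a kernel fact); it does not bear on (E1)∕(E3); K0⁷ stub 1 NOT closed; N05 ∕ N07 NOT discharged; counts unmoved
(typed 28∕28 · discharged 8∕28); one finite 𝕋⁴ programme at fixed ε — R4 closes the conditional finite-𝕋⁴ rung `BalabanLadder.UV` only; the YM mass gap (Clay)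
is NOT proved by any of this; nothing continuum ∕ ℝ⁴ ∕ OS.  No `def`, no `instance`, no `notation`, no `sorry`.

References: [I] (0.3)–(0.7) pp. 252–253; [B7] (8)–(11) p. 19; [15] (5)–(6) p. 278; [II] (2.3) p. 224.
-/

set_option autoImplicit false

noncomputable section

open scoped Matrix.Norms.L2Operator BigOperators

namespace Summit.QuantumFields.YangMills.BalabanUVNodes.N07SeamWitness

open Literature.MathematicalPhysics.QuantumFieldTheory.Balaban1983to89
open Literature.MathematicalPhysics.QuantumFieldTheory.Balaban1983to89.T4Continuum
open BlockAveraging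
open Literature.MathematicalPhysics.QuantumFieldTheory.Balaban1983to89.T3DescentFibreTower (holAt_one axialAvg_one avgFun_one
  expMeanLogSU_E_one loopHol_one small_one)
open Summit.QuantumFields.YangMills.Theorems.K0AveragedSingleBondFloor (holAt_single_eq_one_of_ne_tgt holAt_single_eq_one_of_ne_src
  holAt_single_segment intCast_ne_zero_of_natAbs_lt walkEnd_take_replicate_apply walkEnd_take_replicate_false_apply loop_position_apply)

/-! ## §1  Two configurations agreeing on every bond a walk can traverse -/
section Walks

variable {P : Params} {j : ℕ} {G : Type*} [GaugeGroup G]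

/-- **Two configurations that differ only on bonds whose TARGET the walk never visits have the same holonomy along it** (a step along a bond, in either
orientation, makes its target a prefix end of the walk: `T4ReflectionConeSharp.exists_tgt_eq_walkEnd_take`). [folklore] -/
theorem holAt_walk_congr_of_ne_tgt (V V' : GaugeField P j G) (x : Site P j) (w : List (Letter P.d))
    (h : ∀ b : PBond P j, V b ≠ V' b → ∀ k, walkEnd x (w.take k) ≠ b.tgt) :
    holAt V (walk x w) = holAt V' (walk x w) := by
  refine T4ReflectionCone.holAt_congr fun s hs => ?_
  by_contra hne
  obtain ⟨k, hk⟩ := T4ReflectionConeSharp.exists_tgt_eq_walkEnd_take x w s hs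
  exact h s.bond hne k hk.symm

/-- **Two configurations that differ only on bonds whose SOURCE the walk never visits have the same holonomy along it** (`BlockAveraging.exists_src_eq_walkEnd_take`).
[folklore] -/
theorem holAt_walk_congr_of_ne_src (V V' : GaugeField P j G) (x : Site P j) (w : List (Letter P.d))
    (h : ∀ b : PBond P j, V b ≠ V' b → ∀ k, walkEnd x (w.take k) ≠ b.src) :
    holAt V (walk x w) = holAt V' (walk x w) := by
  refine T4ReflectionCone.holAt_congr fun s hs => ?_
  by_contra hne
  obtain ⟨k, hk⟩ := exists_src_eq_walkEnd_take x w s hs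
  exact h s.bond hne k hk.symm

end Walks

/-! ## §2  Avoidance by one coordinate of the (0.4) box at `c`: two configurations have the same `Ū(c)` -/
section Avoid

variable {P : Params} {j : ℕ} {G : Type*} [GaugeGroup G]

/-- **THE LOOP VARIABLES OF (0.4) AT `c` AGREE** for two configurations that differ only on bonds `b` whose target misses, in one coordinate `κ`, every admissible
position `emb c₋ κ + e` (`−h ≤ e ≤ [c.dir = κ]·L + h`, `h = (L−1)∕2`) of the loops `Γ ∪ [x,x′] ∪ (−Γ′) ∪ (−c)` (`loop_position_apply`).
[cite: Balaban1987RG1, (0.3)–(0.4) pp.252–253 (bookkeeping)] -/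
theorem loopHol_congr_of_coord (c : PBond P (j + 1)) (V V' : GaugeField P j G) (κ : Fin P.d)
    (hκ : ∀ b : PBond P j, V b ≠ V' b → ∀ e : ℤ, -(((P.L - 1) / 2 : ℕ) : ℤ) ≤ e → e ≤ (if c.dir = κ then (P.L : ℤ) else 0) + (((P.L - 1) / 2 : ℕ) : ℤ) →
      emb c.src κ + ((e : ℤ) : ZMod (P.sitesPerDir j)) ≠ b.tgt κ) :
    loopHol V c = loopHol V' c := by
  funext i
  unfold loopHol
  refine holAt_walk_congr_of_ne_tgt V V' _ _ (fun b hb k heq => ?_)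
  obtain ⟨e, he1, he2, he⟩ := loop_position_apply c i k κ
  exact hκ b hb e he1 he2 (by rw [← he, heq])

/-- The same avoidance for the straight transporter `U(c)`. [cite: Balaban1984PropagatorsI, (1.7) p.18 (bookkeeping)] -/
theorem axialAvg_congr_of_coord (c : PBond P (j + 1)) (V V' : GaugeField P j G) (κ : Fin P.d)
    (hκ : ∀ b : PBond P j, V b ≠ V' b → ∀ e : ℤ, -(((P.L - 1) / 2 : ℕ) : ℤ) ≤ e → e ≤ (if c.dir = κ then (P.L : ℤ) else 0) + (((P.L - 1) / 2 : ℕ) : ℤ) →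
      emb c.src κ + ((e : ℤ) : ZMod (P.sitesPerDir j)) ≠ b.tgt κ) :
    AveragingRT.axialAvg V c = AveragingRT.axialAvg V' c := by
  rw [axialAvg_eq_holAt_walk, axialAvg_eq_holAt_walk]
  refine holAt_walk_congr_of_ne_tgt V V' _ _ (fun b hb k heq => ?_)
  have hc := congrFun heq κ
  rw [walkEnd_take_replicate_apply] at hc
  have hm : min k P.L ≤ P.L := Nat.min_le_right _ _
  generalize min k P.L = m at hc hm
  by_cases hdir : c.dir = κ
  · rw [if_pos hdir] at hc
    refine hκ b hb m (by omega) (by rw [if_pos hdir]; omega) ?_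
    rw [← hc]; push_cast; rfl
  · rw [if_neg hdir] at hc
    refine hκ b hb 0 (by omega) (by rw [if_neg hdir]; positivity) ?_
    rw [← hc]; push_cast; rfl

/-- **`Ū(c)` AGREES** for two such configurations, for EVERY small-loop average `ℰ` (the correction factor reads the loop variables, the second factor is the straight
transporter). [cite: Balaban1987RG1, (0.4) p.253 (bookkeeping)] -/
theorem avgFun_congr_of_coord (ℰ : LoopAverage G) (c : PBond P (j + 1)) (V V' : GaugeField P j G) (κ : Fin P.d)
    (hκ : ∀ b : PBond P j, V b ≠ V' b → ∀ e : ℤ, -(((P.L - 1) / 2 : ℕ) : ℤ) ≤ e → e ≤ (if c.dir = κ then (P.L : ℤ) else 0) + (((P.L - 1) / 2 : ℕ) : ℤ) →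
      emb c.src κ + ((e : ℤ) : ZMod (P.sitesPerDir j)) ≠ b.tgt κ) :
    avgFun ℰ V c = avgFun ℰ V' c := by
  have hl := loopHol_congr_of_coord c V V' κ hκ
  have hc : corr ℰ V c = corr ℰ V' c := by
    unfold corr BlockAveraging.Small
    rw [hl]
  show corr ℰ V c * AveragingRT.axialAvg V c = corr ℰ V' c * AveragingRT.axialAvg V' c
  rw [hc, axialAvg_congr_of_coord c V V' κ hκ]

end Avoid

/-! ## §3  Holonomy of a pointwise product of commuting configurations -/
section Product

variable {P : Params} {j : ℕ} {G : Type*} [GaugeGroup G]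

/-- An element commuting with every bond variable commutes with every holonomy. [folklore] -/
theorem commute_holAt (V : GaugeField P j G) (g : G) (hg : ∀ b, V b * g = g * V b) (γ : List (LStep P j)) :
    holAt V γ * g = g * holAt V γ := by
  induction γ with
  | nil => rw [holAt_nil, one_mul, mul_one]
  | cons s γ ih =>
    rw [holAt_cons, mul_assoc, ih, ← mul_assoc, ← mul_assoc]
    congr 1
    split_ifs
    · exact hg s.bond
    · have hb := hg s.bond
      calc (V s.bond)⁻¹ * g = (V s.bond)⁻¹ * g * (V s.bond * (V s.bond)⁻¹) := by rw [mul_inv_cancel, mul_one]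
        _ = (V s.bond)⁻¹ * (g * V s.bond) * (V s.bond)⁻¹ := by simp only [mul_assoc]
        _ = (V s.bond)⁻¹ * (V s.bond * g) * (V s.bond)⁻¹ := by rw [hb]
        _ = g * (V s.bond)⁻¹ := by rw [← mul_assoc, inv_mul_cancel, one_mul]
/-- **HOLONOMY IS MULTIPLICATIVE ON POINTWISE PRODUCTS OF COMMUTING CONFIGURATIONS**: if every `V b` commutes with every `V′ b′` then
`𝒰(γ)(V·V′) = 𝒰(γ)(V) · 𝒰(γ)(V′)` along every sequence of steps. [folklore] -/
theorem holAt_mul_of_commute (V V' : GaugeField P j G) (h : ∀ b b', V b * V' b' = V' b' * V b) (γ : List (LStep P j)) :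
    holAt (fun b => V b * V' b) γ = holAt V γ * holAt V' γ := by
  induction γ with
  | nil => simp [holAt_nil]
  | cons s γ ih =>
    rw [holAt_cons, holAt_cons, holAt_cons, ih]
    have hc : ∀ b', holAt V γ * V' b' = V' b' * holAt V γ := fun b' => commute_holAt V (V' b') (fun b => h b b') γ
    have hci : ∀ b', holAt V γ * (V' b')⁻¹ = (V' b')⁻¹ * holAt V γ := fun b' => by
      have := hc b'
      calc holAt V γ * (V' b')⁻¹ = (V' b')⁻¹ * (V' b' * holAt V γ) * (V' b')⁻¹ := by rw [inv_mul_cancel_left]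
        _ = (V' b')⁻¹ * (holAt V γ * V' b') * (V' b')⁻¹ := by rw [this]
        _ = (V' b')⁻¹ * holAt V γ := by rw [mul_assoc, mul_assoc, mul_inv_cancel, mul_one]
    by_cases hf : s.fwd
    · simp only [hf, if_true]
      rw [mul_assoc, ← mul_assoc (V' s.bond), ← hc s.bond, mul_assoc, mul_assoc]
    · simp only [hf, if_false, Bool.false_eq_true]
      have hinv : (V s.bond * V' s.bond)⁻¹ = (V s.bond)⁻¹ * (V' s.bond)⁻¹ := by
        rw [h s.bond s.bond, mul_inv_rev]
      rw [hinv, mul_assoc, ← mul_assoc (V' s.bond)⁻¹, ← hci s.bond, mul_assoc, mul_assoc]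

/-- Hence the loop variables of (0.4) of a pointwise product of commuting configurations are the products. [cite: Balaban1987RG1, (0.4) p.253 (bookkeeping)] -/
theorem loopHol_mul_of_commute (V V' : GaugeField P j G) (h : ∀ b b', V b * V' b' = V' b' * V b) (c : PBond P (j + 1)) (i : Idx P) :
    loopHol (fun b => V b * V' b) c i = loopHol V c i * loopHol V' c i :=
  holAt_mul_of_commute V V' h _

/-- And so is the straight transporter. [cite: Balaban1984PropagatorsI, (1.7) p.18 (bookkeeping)] -/
theorem axialAvg_mul_of_commute (V V' : GaugeField P j G) (h : ∀ b b', V b * V' b' = V' b' * V b) (c : PBond P (j + 1)) :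
    AveragingRT.axialAvg (fun b => V b * V' b) c = AveragingRT.axialAvg V c * AveragingRT.axialAvg V' c := by
  rw [axialAvg_eq_holAt_walk, axialAvg_eq_holAt_walk, axialAvg_eq_holAt_walk]
  exact holAt_mul_of_commute V V' h _

end Product


/-! ## §4  The (0.4) loop variables at `c⋆ = ⟨y₁, μ₀⟩` of the configuration twisted at ONE interface bond at transverse offset `ρ` -/
section Star

variable {P : Params} {j : ℕ} {G : Type*} [GaugeGroup G]

/-- **THE LOOP VARIABLES OF (0.4) AT `c⋆ = ⟨y₁, μ₀⟩` IN THE SINGLE-BOND CONFIGURATION twisted at the interface bond `⟨x′, μ₀⟩` at TRANSVERSE OFFSET `ρ`**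
(`x′_{μ₀} = emb y₁ _{μ₀} + h`: the bond crosses from `B(y₁)` into `B(y₁ + e_{μ₀})`; `x′_κ + h = emb y₁ κ + ρ_κ` for `κ ≠ μ₀`, `ρ_κ ≤ L − 1`; `ρ_{κ₁} ≠ h` for one
transverse `κ₁`, i.e. the bond is OFF the central axis): the loop `Γ ∪ [x,x′′] ∪ (−Γ′) ∪ (−c⋆)` of index `(r, σ, σ′)` reads the twisted bond — through its segment
`[x, x′′]`, once, forward: value `g` — exactly when its point `x` lies on the bond's axis (`r_κ = ρ_κ` for all `κ ≠ μ₀`), and has holonomy `1` otherwise (the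
staircases stay in their blocks; `−c⋆` runs on the central axis; `d ≥ 2`, `L ≥ 3`, torus longer than `2L`).  dag-n21-c's `loopHol_single_star` is the case `ρ = 0`.
[cite: Balaban1987RG1, (0.3)–(0.4) pp.252–253 (bookkeeping)] -/
theorem loopHol_single_offset_star (hper : 2 * P.L < P.sitesPerDir j) (hL : 3 ≤ P.L) {κ₁ μ0 : Fin P.d} (hκ₁ : κ₁ ≠ μ0) (y₁ : Site P (j + 1))
    (x' : Site P j) (g : G) (ρ : Fin P.d → ℕ) (hρL : ∀ κ, ρ κ < P.L) (hρκ₁ : ρ κ₁ ≠ (P.L - 1) / 2)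
    (hx0 : x' μ0 = emb y₁ μ0 + (((P.L - 1) / 2 : ℕ) : ZMod (P.sitesPerDir j)))
    (hxκ : ∀ κ, κ ≠ μ0 → x' κ + (((P.L - 1) / 2 : ℕ) : ZMod (P.sitesPerDir j)) = emb y₁ κ + ((ρ κ : ℕ) : ZMod (P.sitesPerDir j))) (i : Idx P) :
    loopHol (fun b : PBond P j => if b.src = x' ∧ b.dir = μ0 then g else 1) ⟨y₁, μ0⟩ i =
      if (∀ κ, κ ≠ μ0 → (i.1 κ : ℕ) = ρ κ) then g else 1 := by
  classical
  set U : GaugeField P j G := fun b => if b.src = x' ∧ b.dir = μ0 then g else 1 with hU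
  set h : ℕ := (P.L - 1) / 2 with hh
  have hL2 : 2 * h + 1 = P.L := AveragingRT.two_mul_half_add_one P
  obtain ⟨r, σ, σ'⟩ := i
  set n : Fin P.d → ℤ := off r with hn
  have hnb : ∀ κ, -(h : ℤ) ≤ n κ ∧ n κ ≤ h := fun κ => off_bounds r κ
  -- the four pieces
  unfold loopHol
  simp only [loopWord]
  rw [walk_append, holAt_append, walk_append, holAt_append, walk_append, holAt_append]
  -- starts of the pieces
  set x : Site P j := walkEnd (emb y₁) (stairWord σ n) with hxdef
  have hx : ∀ κ, x κ = emb y₁ κ + ((n κ : ℤ) : ZMod (P.sitesPerDir j)) := fun κ => BlockAveragingEMLProp2.walkEnd_stairWord_apply (emb y₁) σ n κ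
  set x2 : Site P j := walkEnd x (List.replicate P.L (μ0, true)) with hx2def
  have hx2 : ∀ κ, x2 κ = x κ + (if μ0 = κ then (P.L : ZMod (P.sitesPerDir j)) else 0) := by
    intro κ
    have := walkEnd_take_replicate_apply x μ0 P.L P.L κ
    rw [List.take_of_length_le (by rw [List.length_replicate]), min_self] at this
    rw [hx2def, this]
  set x3 : Site P j := walkEnd x2 (wordRev (stairWord σ' n)) with hx3def
  have hx3 : ∀ κ, x3 κ = x2 κ - ((n κ : ℤ) : ZMod (P.sitesPerDir j)) := by
    intro κ; rw [hx3def, walkEnd_apply, netDisp_wordRev, netDisp_stairWord, Int.cast_neg, sub_eq_add_neg]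
  -- the target's transverse coordinates: `x′ κ = emb y₁ κ + ρ κ − h`
  have hx' : ∀ κ, κ ≠ μ0 → x' κ = emb y₁ κ + ((ρ κ : ℕ) : ZMod (P.sitesPerDir j)) - ((h : ℕ) : ZMod (P.sitesPerDir j)) :=
    fun κ hκ => eq_sub_of_add_eq (hxκ κ hκ)
  -- piece 1: the staircase `Γ` from `emb y₁` never visits `x′ + e_{μ₀}` (coordinate `μ₀`)
  have H1 : holAt U (walk (emb y₁) (stairWord σ n)) = 1 := by
    refine holAt_single_eq_one_of_ne_tgt x' μ0 g _ _ (fun k heq => ?_)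
    have hc := congrFun heq μ0
    rw [walkEnd_apply, Site.shift_apply, if_pos rfl, hx0] at hc
    have hb := netDisp_take_stairWord σ n μ0 k
    generalize netDisp ((stairWord σ n).take k) μ0 = e at hc hb
    have hc' : (((e : ℤ) - h - 1 : ℤ) : ZMod (P.sitesPerDir j)) = 0 := by
      have := sub_eq_zero.mpr hc; push_cast at this ⊢; linear_combination this
    have hb' := hnb μ0
    have hne : ((e : ℤ) - h - 1 : ℤ) ≠ 0 := by
      rcases le_total 0 (n μ0) with h0 | h0
      · rw [min_eq_left h0, max_eq_right h0] at hb; omega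
      · rw [min_eq_right h0, max_eq_left h0] at hb; omega
    have hlt : (((e : ℤ) - h - 1 : ℤ)).natAbs < P.sitesPerDir j := by
      rcases le_total 0 (n μ0) with h0 | h0
      · rw [min_eq_left h0, max_eq_right h0] at hb; omega
      · rw [min_eq_right h0, max_eq_left h0] at hb; omega
    exact intCast_ne_zero_of_natAbs_lt hne hlt hc'
  -- piece 3: the reversed staircase `−Γ′` from `x′′ = x + L e_{μ₀}` never visits `x′` (coordinate `μ₀`)
  have H3 : holAt U (walk x2 (wordRev (stairWord σ' n))) = 1 := by
    refine holAt_single_eq_one_of_ne_src x' μ0 g _ _ (fun k heq => ?_)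
    have hc := congrFun heq μ0
    obtain ⟨m, hm⟩ := netDisp_take_wordRev (stairWord σ' n) k
    rw [walkEnd_apply, hm μ0, netDisp_stairWord, hx2, if_pos rfl, hx, hx0] at hc
    have hb := netDisp_take_stairWord σ' n μ0 m
    generalize netDisp ((stairWord σ' n).take m) μ0 = e at hc hb
    have hc' : (((e : ℤ) + (2 * h + 1 : ℕ) - h : ℤ) : ZMod (P.sitesPerDir j)) = 0 := by
      rw [hL2]
      have := sub_eq_zero.mpr hc; push_cast at this ⊢; linear_combination this
    have hb' := hnb μ0
    have hne : ((e : ℤ) + (2 * h + 1 : ℕ) - h : ℤ) ≠ 0 := by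
      rcases le_total 0 (n μ0) with h0 | h0
      · rw [min_eq_left h0, max_eq_right h0] at hb; push_cast; omega
      · rw [min_eq_right h0, max_eq_left h0] at hb; push_cast; omega
    have hlt : (((e : ℤ) + (2 * h + 1 : ℕ) - h : ℤ)).natAbs < P.sitesPerDir j := by
      rcases le_total 0 (n μ0) with h0 | h0
      · rw [min_eq_left h0, max_eq_right h0] at hb; push_cast; omega
      · rw [min_eq_right h0, max_eq_left h0] at hb; push_cast; omega
    exact intCast_ne_zero_of_natAbs_lt hne hlt hc'
  -- piece 4: the central axis `−c⋆` from `emb (y₁ + e_{μ₀})` never visits `x′ + e_{μ₀}` (transverse coordinate `κ₁`: the bond is off the central axis)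
  have H4 : holAt U (walk x3 (List.replicate P.L (μ0, false))) = 1 := by
    refine holAt_single_eq_one_of_ne_tgt x' μ0 g _ _ (fun k heq => ?_)
    have hc := congrFun heq κ₁
    rw [walkEnd_take_replicate_false_apply, if_neg (Ne.symm hκ₁), sub_zero, hx3, hx2, if_neg (Ne.symm hκ₁), add_zero, hx,
      Site.shift_apply, if_neg hκ₁, hx' κ₁ hκ₁] at hc
    -- `emb y₁ κ₁ + n κ₁ - n κ₁ = emb y₁ κ₁ + ρ κ₁ - h`, i.e. `ρ κ₁ = h` mod the period
    have hc' : ((((ρ κ₁ : ℕ) : ℤ) - h : ℤ) : ZMod (P.sitesPerDir j)) = 0 := by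
      have := sub_eq_zero.mpr hc; push_cast at this ⊢; linear_combination -this
    have hρ1 := hρL κ₁
    have hne : (((ρ κ₁ : ℕ) : ℤ) - h : ℤ) ≠ 0 := by
      intro h0; apply hρκ₁; omega
    have hlt : ((((ρ κ₁ : ℕ) : ℤ) - h : ℤ)).natAbs < P.sitesPerDir j := by omega
    exact intCast_ne_zero_of_natAbs_lt hne hlt hc'
  rw [H1, one_mul, H3, H4, mul_one, mul_one]
  -- piece 2: the transported segment `[x, x′′]`
  by_cases hcar : ∀ κ, κ ≠ μ0 → (r κ : ℕ) = ρ κ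
  · rw [if_pos hcar]
    -- on the axis of the twisted bond: `x = x′ − a e_{μ₀}` with `a = h − n_{μ₀}`
    have ha0 : 0 ≤ (h : ℤ) - n μ0 := by have := (hnb μ0).2; omega
    set a : ℕ := ((h : ℤ) - n μ0).toNat with hadef
    have ha : ((a : ℕ) : ℤ) = (h : ℤ) - n μ0 := Int.toNat_of_nonneg ha0
    have haL : a < P.L := by have := (hnb μ0).1; omega
    refine holAt_single_segment (by omega) x' μ0 g haL x ?_ (fun κ hκ => ?_)
    · rw [hx, hx0]
      have : ((a : ℕ) : ZMod (P.sitesPerDir j)) = (((h : ℤ) - n μ0 : ℤ) : ZMod (P.sitesPerDir j)) := by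
        rw [← ha, Int.cast_natCast]
      rw [this]; push_cast; ring
    · rw [hx, hx' κ hκ]
      have hnκ : n κ = ((ρ κ : ℕ) : ℤ) - (h : ℤ) := by
        show off r κ = _
        simp only [off, hcar κ hκ, hh]
      rw [hnκ]; push_cast; ring
  · rw [if_neg hcar]
    push Not at hcar
    obtain ⟨κ₂, hκ₂, hr⟩ := hcar
    -- off the axis: the transverse coordinate `κ₂` of the segment is `emb y₁ κ₂ + n κ₂ ≠ emb y₁ κ₂ + ρ κ₂ − h`
    refine holAt_single_eq_one_of_ne_tgt x' μ0 g _ _ (fun k heq => ?_)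
    have hc := congrFun heq κ₂
    rw [walkEnd_take_replicate_apply, if_neg (Ne.symm hκ₂), add_zero, hx, Site.shift_apply, if_neg hκ₂, hx' κ₂ hκ₂] at hc
    have hc' : (((n κ₂ : ℤ) + h - ((ρ κ₂ : ℕ) : ℤ) : ℤ) : ZMod (P.sitesPerDir j)) = 0 := by
      have := sub_eq_zero.mpr hc; push_cast at this ⊢; linear_combination this
    have hρ2 := hρL κ₂
    have hr2 := (r κ₂).isLt
    have e1 : n κ₂ = ((r κ₂ : ℕ) : ℤ) - h := rfl
    have hnκ : (n κ₂ : ℤ) + h - ((ρ κ₂ : ℕ) : ℤ) ≠ 0 := by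
      intro h0
      apply hr
      have : ((r κ₂ : ℕ) : ℤ) = ((ρ κ₂ : ℕ) : ℤ) := by omega
      exact_mod_cast this
    have hlt : (((n κ₂ : ℤ) + h - ((ρ κ₂ : ℕ) : ℤ) : ℤ)).natAbs < P.sitesPerDir j := by omega
    exact intCast_ne_zero_of_natAbs_lt hnκ hlt hc'

/-- The straight transporter `U(c⋆)` runs on the central axis of the two blocks and misses the twisted bond (transverse coordinate `κ₁`, `ρ_{κ₁} ≠ h`).
[cite: Balaban1984PropagatorsI, (1.7) p.18 (bookkeeping)] -/
theorem axialAvg_single_offset_star (hper : 2 * P.L < P.sitesPerDir j) (hL : 3 ≤ P.L) {κ₁ μ0 : Fin P.d} (hκ₁ : κ₁ ≠ μ0) (y₁ : Site P (j + 1))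
    (x' : Site P j) (g : G) (ρ : Fin P.d → ℕ) (hρL : ∀ κ, ρ κ < P.L) (hρκ₁ : ρ κ₁ ≠ (P.L - 1) / 2)
    (hxκ : ∀ κ, κ ≠ μ0 → x' κ + (((P.L - 1) / 2 : ℕ) : ZMod (P.sitesPerDir j)) = emb y₁ κ + ((ρ κ : ℕ) : ZMod (P.sitesPerDir j))) :
    AveragingRT.axialAvg (fun b : PBond P j => if b.src = x' ∧ b.dir = μ0 then g else 1) ⟨y₁, μ0⟩ = 1 := by
  set h : ℕ := (P.L - 1) / 2 with hh
  have hL2 : 2 * h + 1 = P.L := AveragingRT.two_mul_half_add_one P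
  have hx' : x' κ₁ = emb y₁ κ₁ + ((ρ κ₁ : ℕ) : ZMod (P.sitesPerDir j)) - ((h : ℕ) : ZMod (P.sitesPerDir j)) :=
    eq_sub_of_add_eq (hxκ κ₁ hκ₁)
  rw [axialAvg_eq_holAt_walk]
  refine holAt_single_eq_one_of_ne_tgt x' μ0 g _ _ (fun k heq => ?_)
  have hc := congrFun heq κ₁
  rw [walkEnd_take_replicate_apply] at hc
  simp only at hc
  rw [if_neg (Ne.symm hκ₁), add_zero, Site.shift_apply, if_neg hκ₁, hx'] at hc
  have hc' : ((((ρ κ₁ : ℕ) : ℤ) - h : ℤ) : ZMod (P.sitesPerDir j)) = 0 := by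
    have := sub_eq_zero.mpr hc; push_cast at this ⊢; linear_combination -this
  have hρ1 := hρL κ₁
  have hne : (((ρ κ₁ : ℕ) : ℤ) - h : ℤ) ≠ 0 := by
    intro h0; apply hρκ₁; omega
  have hlt : ((((ρ κ₁ : ℕ) : ℤ) - h : ℤ)).natAbs < P.sitesPerDir j := by omega
  exact intCast_ne_zero_of_natAbs_lt hne hlt hc'

end Star


end Summit.QuantumFields.YangMills.BalabanUVNodes.N07SeamWitness

end
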